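import Summits.Schanuel.Schanuel.Theses.DiophantineDichotomy
import HarnessLib

/-!
# The RACE FORM of crux `ApproximationProperty` (stmt-Schanuel-6117) — definitions module

Route `DiophantineDichotomy` (sub-problem `Schanuel/Schanuel`), crux
`Summit.Schanuel.Schanuel.Theses.DiophantineDichotomy.ApproximationProperty` (Philippon's
approximation property in transcendence degree `t`, ALL scales `Y ≥ Δ ≥ c(θ)`, with the height
budget `log H ≤ c Y Δ^{t-1}`).

This file records, as a `def … : Prop` (nothing is asserted), the WEAKER statement that the route's
deciding theorem `Summit.Schanuel.Schanuel.Theses.DiophantineDichotomy.closes` actually CONSUMES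
(line lead `prover-line-stmt-Schanuel-6117-c10-0`, KERNEL-c10.md §5): `closes` applies the crux at
ONE scale `Δ = Δ(c, C, a) ≥ c` and ONE sufficiently large `Y` ("race compactness: fix `Δ`, let
`Y → ∞`"), and it DISCARDS the height budget. Hence the following suffices for the route:

* `ApproximationPropertyRace` — for `θ ∈ ℂ^ι` with `trdeg_ℚ ℚ(θ) ≤ t` (`t ≥ 1`) there is `c ≥ 1`
  such that for COFINALLY many `Δ` (`∀ Δ₀ ∃ Δ ≥ max(Δ₀, c)`) and, at each such `Δ`, COFINALLY many
  `Y` (`∀ Y₀ ∃ Y ≥ Y₀`) there is an algebraic `γ` with joint degree `≤ d ≤ (cΔ)^t`, coordinates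
  roots of non-zero integer polynomials of degree `≤ d` and height `≤ H`, and
  `‖γ − θ‖ ≤ exp(−(log H·Δ + d·Y)/c)` — NO height budget, NO "all scales".

`ApproximationProperty → ApproximationPropertyRace` is trivial (`apRace_of_approximationProperty`
below, a registered sub-goal: pure bookkeeping) and
`ApproximationPropertyRace → KhovanskiiApproxTypeEv → KhovanskiiReduction → Schanuel` is `closes`
with five lines changed, proved in the sibling proof file
`DiophantineDichotomyApproximationPropertyRace.lean` (registered sub-goal `schanuel_of_apRace`).
Why it matters (planning, not a proof of anything open): at a FIXED `Δ` the race form is a statement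
about simultaneous approximation by algebraic points of BOUNDED degree `(cΔ)^t` with exponent
`Δ/c` in the height — the regime of the one-dimensional theory (Wirsing, Davenport–Schmidt, and
the all-scales output-dependent theorem `Literature…Bugeaud2004_thm_8_11`, PROVED in the tree) plus
lifting along the locus of `θ` — and not Philippon's open AP2 for `n ≥ 3` (all scales, output at the
Dirichlet threshold), which is what ten line-lead continuations reduced the crux as filed to.

Sources: NesterenkoPhilippon2001 (LNM 1752) Ch. 4 §4; LaurentRoy1999; Bugeaud2004 Thm 8.11;
RoyWaldschmidt1997 (simultaneous approximation and algebraic independence).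
-/

noncomputable section

-- `Summit.Schanuel.Schanuel.…` is the mandated summit/sub-problem namespace (single-conjunct summit), hence:
set_option linter.dupNamespace false

namespace Summit.Schanuel.Schanuel.Cruxes.ApproximationProperty.Race

open Summit.Schanuel.Schanuel.Theses.DiophantineDichotomy (ApproximationProperty)

/-- **The race form of the approximation property** (what `closes` consumes): for every finite `ι`,
every `θ : ι → ℂ` and `t ≥ 1` with `trdeg_ℚ ℚ(θ) ≤ t` there is `c ≥ 1` such that for every `Δ₀`
there is a scale `Δ ≥ Δ₀`, `Δ ≥ c`, at which, for every `Y₀`, some `Y ≥ Y₀` carries an approximation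
datum `(γ, d, H)`: `[ℚ(γ):ℚ] ≤ d`, every `γᵢ` is a root of a non-zero `P ∈ ℤ[X]` of degree `≤ d` and
height `≤ H`, `d ≤ (cΔ)^t`, and `‖γ − θ‖ ≤ exp(−(log H·Δ + d·Y)/c)`. (Cofinal in `Δ`, cofinal in
`Y`, no height budget; the crux `ApproximationProperty` is the same with `∀ Δ ≥ c`, `∀ Y ≥ Δ` and
`log H ≤ cYΔ^{t-1}` added.) -/
def ApproximationPropertyRace : Prop :=
  ∀ (ι : Type) [Fintype ι] (θ : ι → ℂ) (t : ℕ), 1 ≤ t →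
    Algebra.trdeg ℚ ↥(IntermediateField.adjoin ℚ (Set.range θ)) ≤ (t : Cardinal) →
    ∃ c : ℝ, 1 ≤ c ∧ ∀ Δ₀ : ℝ, ∃ Δ : ℝ, Δ₀ ≤ Δ ∧ c ≤ Δ ∧ ∀ Y₀ : ℝ, ∃ Y : ℝ, Y₀ ≤ Y ∧
      ∃ (γ : ι → ℂ) (d H : ℕ),
        Module.finrank ℚ ↥(IntermediateField.adjoin ℚ (Set.range γ)) ≤ d ∧
        (∀ i, ∃ P : Polynomial ℤ, P ≠ 0 ∧ P.natDegree ≤ d ∧ (∀ k, |P.coeff k| ≤ (H : ℤ)) ∧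
          Polynomial.aeval (γ i) P = 0) ∧
        (d : ℝ) ≤ (c * Δ) ^ t ∧
        ‖γ - θ‖ ≤ Real.exp (-((Real.log H * Δ + d * Y) / c))

/-! ## Sanity (registered sub-goal): the race form is a weakening of the crux -/

/-- **Registered sub-goal `apRace_of_approximationProperty`**: the race form is implied by the crux
(pure bookkeeping: `Δ := max Δ₀ c`, `Y := max Y₀ Δ`, drop the height budget). [folklore] -/
theorem apRace_of_approximationProperty : ApproximationProperty → ApproximationPropertyRace := by
  intro hAP ι _ θ t ht htr
  obtain ⟨c, hc1, h⟩ := hAP ι θ t ht htr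
  refine ⟨c, hc1, fun Δ₀ => ⟨max Δ₀ c, le_max_left _ _, le_max_right _ _, fun Y₀ => ?_⟩⟩
  refine ⟨max Y₀ (max Δ₀ c), le_max_left _ _, ?_⟩
  obtain ⟨γ, d, H, h1, h2, h3, -, h5⟩ := h (max Δ₀ c) (max Y₀ (max Δ₀ c)) (le_max_right _ _)
    (le_max_right _ _)
  exact ⟨γ, d, H, h1, h2, h3, h5⟩

end Summit.Schanuel.Schanuel.Cruxes.ApproximationProperty.Race

end
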